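import Mathlib

/-!
# Degree-`d` layer identity of a chain (`chain_coeff_layer`)

A *chain* is a product `Π_t (1 + x_{v_t} • N_t)` of `3 × 3` matrices over `MvPolynomial σ ℂ`
with constant `N_t`, one factor per letter `(v_t, N_t)` of a list `L`.  If the chain equals
`E_02(P') = Matrix.transvection 0 2 P'`, then for `j ≥ 1` and every finset `S` of variables with
`|S| = j + k`, the coefficient of the multilinear monomial `x^S` in `P'` is a bilinear *cut*
expression `∑_{S' ⊆ S, |S'| = j} ∑_{t < |L|} ∑_c a t c S' * b t c (S ∖ S')` (Nisan's partial
derivative matrix of the degree-`(j + k)` multilinear layer of `P'` has rank `≤ 3 |L|`).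

## Proof

Write `K_R(L)` for the `3 × 3` complex matrix of coefficients of `x^R := ∏_{i ∈ R} x_i` in the
chain of `L`.  Peeling off the first factor gives the recursion
`K_R(e :: L) = K_R(L) + [v_e ∈ R] • N_e * K_{R ∖ {v_e}}(L)`, `K_R([]) = [R = ∅] • 1`
(`coeffMatrix_cons`, `coeffMatrix_nil`), and from the recursion alone (`cut_identity`, an
induction on `L` for an abstract `K` over any ring) we get, for `j ≤ |S|`,
`K_S(L) = ∑_{S' ⊆ S, |S'| = j} ∑_{t < |L|} (K_{S'}(L.take (t+1)) - K_{S'}(L.take t)) *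
  K_{S ∖ S'}(L.drop (t+1)) + [j = 0] • K_S(L)`:
grouping the increasing index sets `T ⊆ [0, |L|)` reading exactly the variables `S` by the
position `t` of their `j`-th element.  Reading off the `(0, 2)` entry gives the statement with
`a t c S' := (K_{S'}(L.take (t+1)) - K_{S'}(L.take t)) 0 c` and
`b t c S'' := K_{S''}(L.drop (t+1)) c 2`.

Only `Mathlib` is used; nothing here is specific to the Valiant setting beyond the `3 × 3` format.
-/

-- `Summit.ValiantsHypothesis.ValiantsHypothesis.…` is the tree's mandated single-conjunct layout.
set_option linter.dupNamespace false

namespace Summit.ValiantsHypothesis.ValiantsHypothesis.Theorems.WordPerSuperQuartic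

open MvPolynomial

/-! ### Indicator exponent vectors `x^R` -/

/-- The exponent vector `∑_{i ∈ R} e_i` of the multilinear monomial `x^R` takes the value
`[x ∈ R]` at `x`. -/
private theorem indicator_apply {σ : Type*} [DecidableEq σ] (R : Finset σ) (x : σ) :
    (∑ i ∈ R, Finsupp.single i 1 : σ →₀ ℕ) x = if x ∈ R then 1 else 0 := by
  simp [Finsupp.finsetSum_apply, Finsupp.single_apply]

/-- The exponent vector of `x^R` vanishes iff `R = ∅`. -/
private theorem indicator_eq_zero_iff {σ : Type*} [DecidableEq σ] (R : Finset σ) :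
    (∑ i ∈ R, Finsupp.single i 1 : σ →₀ ℕ) = 0 ↔ R = ∅ := by
  constructor
  · intro h
    by_contra hne
    obtain ⟨x, hx⟩ := Finset.nonempty_iff_ne_empty.2 hne
    have hx' := DFunLike.congr_fun h x
    rw [indicator_apply, if_pos hx] at hx'
    exact one_ne_zero hx'
  · rintro rfl
    simp

/-- Removing `e_x` from the exponent vector of `x^R` (`x ∈ R`) leaves that of `x^{R ∖ {x}}`. -/
private theorem indicator_sub_single {σ : Type*} [DecidableEq σ] (R : Finset σ) {x : σ}
    (hx : x ∈ R) :
    (∑ i ∈ R, Finsupp.single i 1 : σ →₀ ℕ) - Finsupp.single x 1 =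
      ∑ i ∈ R.erase x, Finsupp.single i 1 := by
  rw [← Finset.sum_erase_add R _ hx, add_tsub_cancel_right]

/-- The coefficient of `x^R` in `x_v * p` is `[v ∈ R] • coeff_{x^{R ∖ {v}}} p`. -/
private theorem coeff_indicator_X_mul {σ : Type*} [DecidableEq σ] (R : Finset σ) (v : σ)
    (p : MvPolynomial σ ℂ) :
    coeff (∑ i ∈ R, Finsupp.single i 1) (X v * p) =
      if v ∈ R then coeff (∑ i ∈ R.erase v, Finsupp.single i 1) p else 0 := by
  rw [coeff_X_mul']
  have hmem : v ∈ (∑ i ∈ R, Finsupp.single i 1 : σ →₀ ℕ).support ↔ v ∈ R := by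
    rw [Finsupp.mem_support_iff, indicator_apply]
    simp
  by_cases hv : v ∈ R
  · rw [if_pos (hmem.2 hv), if_pos hv, indicator_sub_single R hv]
  · rw [if_neg (mt hmem.1 hv), if_neg hv]

/-! ### The coefficient matrices of a chain and their recursion -/

/-- The empty chain is `1`, so its `x^R`-coefficient matrix is `[R = ∅] • 1`. -/
private theorem coeffMatrix_nil {σ : Type} [DecidableEq σ]
    (K : Finset σ → List (σ × Matrix (Fin 3) (Fin 3) ℂ) → Matrix (Fin 3) (Fin 3) ℂ)
    (hK : ∀ R L, K R L = ((L.map (fun e => (1 : Matrix (Fin 3) (Fin 3) (MvPolynomial σ ℂ)) +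
      (X e.1 : MvPolynomial σ ℂ) • e.2.map (C : ℂ → MvPolynomial σ ℂ))).prod).map
        (coeff (∑ i ∈ R, Finsupp.single i 1)))
    (R : Finset σ) : K R [] = if R = ∅ then 1 else 0 := by
  rw [hK, List.map_nil, List.prod_nil]
  ext a b
  rw [Matrix.map_apply, Matrix.one_apply, apply_ite (coeff _), coeff_one, coeff_zero]
  have h0 : (0 : σ →₀ ℕ) = ∑ i ∈ R, Finsupp.single i 1 ↔ R = ∅ := by
    rw [eq_comm, indicator_eq_zero_iff]
  simp only [h0]
  split_ifs with hab hR <;> simp [Matrix.one_apply, hab]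

/-- Peeling off the first factor of a chain: the `x^R`-coefficient matrices satisfy
`K_R(e :: L) = K_R(L) + [v_e ∈ R] • N_e * K_{R ∖ {v_e}}(L)`. -/
private theorem coeffMatrix_cons {σ : Type} [DecidableEq σ]
    (K : Finset σ → List (σ × Matrix (Fin 3) (Fin 3) ℂ) → Matrix (Fin 3) (Fin 3) ℂ)
    (hK : ∀ R L, K R L = ((L.map (fun e => (1 : Matrix (Fin 3) (Fin 3) (MvPolynomial σ ℂ)) +
      (X e.1 : MvPolynomial σ ℂ) • e.2.map (C : ℂ → MvPolynomial σ ℂ))).prod).map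
        (coeff (∑ i ∈ R, Finsupp.single i 1)))
    (R : Finset σ) (e : σ × Matrix (Fin 3) (Fin 3) ℂ) (L : List (σ × Matrix (Fin 3) (Fin 3) ℂ)) :
    K R (e :: L) = K R L + if e.1 ∈ R then e.2 * K (R.erase e.1) L else 0 := by
  rw [hK, hK, hK, List.map_cons, List.prod_cons, Matrix.add_mul, Matrix.one_mul, Matrix.smul_mul]
  ext a b
  simp only [Matrix.map_apply, Matrix.add_apply, Matrix.smul_apply, smul_eq_mul, coeff_add,
    Matrix.mul_apply]
  congr 1
  rw [coeff_indicator_X_mul]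
  split_ifs with hv
  · rw [coeff_sum, Matrix.mul_apply]
    simp only [coeff_C_mul, Matrix.map_apply]
  · rfl

/-! ### The cut identity for an abstract coefficient system -/

/-- From the recursion: `K_∅(L) = 1`. -/
private theorem cut_empty {σ α M : Type*} [DecidableEq σ] [Ring M]
    (K : Finset σ → List α → M) (v : α → σ) (N : α → M)
    (hnil : ∀ R, K R [] = if R = ∅ then 1 else 0)
    (hcons : ∀ R e L, K R (e :: L) = K R L + if v e ∈ R then N e * K (R.erase (v e)) L else 0)
    (L : List α) : K ∅ L = 1 := by
  induction L with
  | nil => rw [hnil, if_pos rfl]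
  | cons e L ih => rw [hcons, ih, if_neg (Finset.notMem_empty _), add_zero]

/-- Boundary term: `∑_{S'' ⊆ R, |S''| = i} K_{S''}([]) * K_{R ∖ S''}(L) = [i = 0] • K_R(L)`. -/
private theorem cut_boundary {σ α M : Type*} [DecidableEq σ] [Ring M]
    (K : Finset σ → List α → M)
    (hnil : ∀ R, K R [] = if R = ∅ then 1 else 0)
    (i : ℕ) (R : Finset σ) (L : List α) :
    ∑ S'' ∈ R.powersetCard i, K S'' [] * K (R \ S'') L = if i = 0 then K R L else 0 := by
  cases i with
  | zero => simp [Finset.powersetCard_zero, hnil]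
  | succ i =>
    rw [if_neg (Nat.add_one_ne_zero i)]
    refine Finset.sum_eq_zero fun S'' hS'' => ?_
    rw [hnil, if_neg, zero_mul]
    rintro rfl
    rw [Finset.mem_powersetCard, Finset.card_empty] at hS''
    exact Nat.add_one_ne_zero i hS''.2.symm

/-- Reindexing the `(i+1)`-subsets of `S` through `x ∈ S` by their traces on `S ∖ {x}`. -/
private theorem sum_powersetCard_insert {σ M : Type*} [DecidableEq σ] [AddCommMonoid M]
    (f : Finset σ → M) {S : Finset σ} {x : σ} (hx : x ∈ S) (i : ℕ) :
    ∑ S' ∈ S.powersetCard (i + 1), (if x ∈ S' then f S' else 0) =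
      ∑ S'' ∈ (S.erase x).powersetCard i, f (insert x S'') := by
  rw [← Finset.sum_filter]
  refine Finset.sum_nbij' (fun S' => S'.erase x) (fun S'' => insert x S'') ?_ ?_ ?_ ?_ ?_
  · intro S' hS'
    obtain ⟨hS', hxS'⟩ := Finset.mem_filter.1 hS'
    obtain ⟨hsub, hcard⟩ := Finset.mem_powersetCard.1 hS'
    exact Finset.mem_powersetCard.2 ⟨Finset.erase_subset_erase x hsub,
      by rw [Finset.card_erase_of_mem hxS', hcard, Nat.add_sub_cancel]⟩
  · intro S'' hS''
    obtain ⟨hsub, hcard⟩ := Finset.mem_powersetCard.1 hS''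
    have hxS'' : x ∉ S'' := fun h => (Finset.mem_erase.1 (hsub h)).1 rfl
    exact Finset.mem_filter.2 ⟨Finset.mem_powersetCard.2
      ⟨Finset.insert_subset hx (hsub.trans (Finset.erase_subset x S)),
        by rw [Finset.card_insert_of_notMem hxS'', hcard]⟩, Finset.mem_insert_self x S''⟩
  · intro S' hS'
    exact Finset.insert_erase (Finset.mem_filter.1 hS').2
  · intro S'' hS''
    exact Finset.erase_insert fun h =>
      (Finset.mem_erase.1 ((Finset.mem_powersetCard.1 hS'').1 h)).1 rfl
  · intro S' hS'
    rw [Finset.insert_erase (Finset.mem_filter.1 hS').2]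

/-- One step of the cut: the `t`-sum for the chain `e :: L` splits into the `t`-sum for `L` and
the contribution of the new first factor. -/
private theorem cut_summand {σ α M : Type*} [DecidableEq σ] [Ring M]
    (K : Finset σ → List α → M) (v : α → σ) (N : α → M)
    (hcons : ∀ R e L, K R (e :: L) = K R L + if v e ∈ R then N e * K (R.erase (v e)) L else 0)
    (e : α) (L : List α) (S' R : Finset σ) :
    ∑ t ∈ Finset.range (e :: L).length,
        (K S' ((e :: L).take (t + 1)) - K S' ((e :: L).take t)) * K R ((e :: L).drop (t + 1)) =
      (∑ t ∈ Finset.range L.length,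
        (K S' (L.take (t + 1)) - K S' (L.take t)) * K R (L.drop (t + 1))) +
      if v e ∈ S' then N e * (K (S'.erase (v e)) [] * K R L + ∑ t ∈ Finset.range L.length,
        (K (S'.erase (v e)) (L.take (t + 1)) - K (S'.erase (v e)) (L.take t)) * K R (L.drop (t + 1)))
      else 0 := by
  rw [List.length_cons, Finset.sum_range_succ']
  simp only [List.take_succ_cons, List.take_zero, List.drop_succ_cons, List.drop_zero, hcons,
    add_sub_cancel_left]
  by_cases h : v e ∈ S'
  · simp only [h, if_true, add_sub_add_comm, add_mul, Finset.sum_add_distrib, mul_add,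
      Finset.mul_sum, ← mul_sub, mul_assoc]
    abel
  · simp [h]

/-- **Cut identity.**  For a coefficient system `K` with the chain recursion, `j ≤ |S|`:
`K_S(L) = ∑_{S' ⊆ S, |S'| = j} ∑_{t < |L|} (K_{S'}(L.take (t+1)) - K_{S'}(L.take t)) *
K_{S ∖ S'}(L.drop (t+1)) + [j = 0] • K_S(L)` (group the index sets reading `x^S` by the
position of their `j`-th element). -/
private theorem cut_identity {σ α M : Type*} [DecidableEq σ] [Ring M]
    (K : Finset σ → List α → M) (v : α → σ) (N : α → M)
    (hnil : ∀ R, K R [] = if R = ∅ then 1 else 0)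
    (hcons : ∀ R e L, K R (e :: L) = K R L + if v e ∈ R then N e * K (R.erase (v e)) L else 0)
    (L : List α) (j : ℕ) (S : Finset σ) (hjS : j ≤ S.card) :
    K S L = (∑ S' ∈ S.powersetCard j, ∑ t ∈ Finset.range L.length,
        (K S' (L.take (t + 1)) - K S' (L.take t)) * K (S \ S') (L.drop (t + 1))) +
      if j = 0 then K S L else 0 := by
  induction L generalizing j S with
  | nil =>
    rw [List.length_nil, Finset.range_zero]
    simp only [Finset.sum_empty, Finset.sum_const_zero, zero_add]
    split_ifs with hj
    · rfl
    · rw [hnil, if_neg]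
      rintro rfl
      rw [Finset.card_empty, Nat.le_zero] at hjS
      exact hj hjS
  | cons e L ih =>
    cases j with
    | zero =>
      rw [if_pos rfl, Finset.powersetCard_zero, Finset.sum_singleton]
      simp [cut_empty K v N hnil hcons]
    | succ i =>
      rw [if_neg (Nat.add_one_ne_zero i), add_zero]
      simp only [cut_summand K v N hcons]
      rw [Finset.sum_add_distrib, hcons, ih (i + 1) S hjS, if_neg (Nat.add_one_ne_zero i),
        add_zero, add_right_inj]
      by_cases hv : v e ∈ S
      · rw [if_pos hv, sum_powersetCard_insert _ hv, ← Finset.mul_sum]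
        congr 1
        have hcard : i ≤ (S.erase (v e)).card := by
          rw [Finset.card_erase_of_mem hv]
          omega
        rw [ih i _ hcard, ← cut_boundary K hnil i (S.erase (v e)) L, ← Finset.sum_add_distrib]
        refine Finset.sum_congr rfl fun S'' hS'' => ?_
        have hvS'' : v e ∉ S'' := fun h =>
          (Finset.mem_erase.1 ((Finset.mem_powersetCard.1 hS'').1 h)).1 rfl
        rw [Finset.erase_insert hvS'', Finset.sdiff_insert, ← Finset.erase_sdiff_comm, add_comm]
      · rw [if_neg hv]
        refine (Finset.sum_eq_zero fun S' hS' => if_neg fun h => hv ?_).symm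
        exact (Finset.mem_powersetCard.1 hS').1 h

/-! ### The layer identity -/

/-- **Layer identity of a chain.**  If the chain `Π_t (1 + x_{v_t} • N_t)` of `L` equals
`E_02(P')`, then for `j ≥ 1` there are `a b : ℕ → Fin 3 → Finset σ → ℂ` such that for every
finset `S` of `j + k` variables the coefficient of `x^S` in `P'` is
`∑_{S' ⊆ S, |S'| = j} ∑_{t < |L|} ∑_c a t c S' * b t c (S ∖ S')`; explicitly
`a t c S' = (K_{S'}(L.take (t+1)) - K_{S'}(L.take t)) 0 c` and `b t c S'' = K_{S''}(L.drop (t+1)) c 2`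
with `K_R` the `x^R`-coefficient matrix of a chain. -/
theorem chain_coeff_layer : ∀ {σ : Type} [DecidableEq σ] (L : List (σ × Matrix (Fin 3) (Fin 3) ℂ)) (P' : MvPolynomial σ ℂ), (L.map (fun e => (1 : Matrix (Fin 3) (Fin 3) (MvPolynomial σ ℂ)) + (MvPolynomial.X e.1 : MvPolynomial σ ℂ) • e.2.map (MvPolynomial.C : ℂ → MvPolynomial σ ℂ))).prod = Matrix.transvection (0 : Fin 3) 2 P' → ∀ j k : ℕ, 0 < j → ∃ a b : ℕ → Fin 3 → Finset σ → ℂ, ∀ S : Finset σ, S.card = j + k → MvPolynomial.coeff (∑ i ∈ S, Finsupp.single i 1) P' = ∑ S' ∈ S.powersetCard j, ∑ t ∈ Finset.range L.length, ∑ c : Fin 3, a t c S' * b t c (S \ S') := by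
  intro σ _ L P' hL j k hj
  -- the `x^R`-coefficient matrices of the chains of sublists of `L`
  let K : Finset σ → List (σ × Matrix (Fin 3) (Fin 3) ℂ) → Matrix (Fin 3) (Fin 3) ℂ :=
    fun R L₀ => ((L₀.map (fun e => (1 : Matrix (Fin 3) (Fin 3) (MvPolynomial σ ℂ)) +
      (X e.1 : MvPolynomial σ ℂ) • e.2.map (C : ℂ → MvPolynomial σ ℂ))).prod).map
        (coeff (∑ i ∈ R, Finsupp.single i 1))
  have hK : ∀ R L₀, K R L₀ = ((L₀.map (fun e => (1 : Matrix (Fin 3) (Fin 3) (MvPolynomial σ ℂ)) +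
      (X e.1 : MvPolynomial σ ℂ) • e.2.map (C : ℂ → MvPolynomial σ ℂ))).prod).map
        (coeff (∑ i ∈ R, Finsupp.single i 1)) := fun _ _ => rfl
  refine ⟨fun t c S' => (K S' (L.take (t + 1)) - K S' (L.take t)) 0 c,
    fun t c S'' => K S'' (L.drop (t + 1)) c 2, fun S hS => ?_⟩
  have hcut := cut_identity K Prod.fst Prod.snd (coeffMatrix_nil K hK) (coeffMatrix_cons K hK)
    L j S (by omega)
  rw [if_neg hj.ne', add_zero] at hcut
  have h02 : coeff (∑ i ∈ S, Finsupp.single i 1) P' = K S L 0 2 := by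
    rw [hK, Matrix.map_apply, hL]
    simp [Matrix.transvection]
  rw [h02, hcut]
  simp only [Matrix.sum_apply, Matrix.mul_apply]

end Summit.ValiantsHypothesis.ValiantsHypothesis.Theorems.WordPerSuperQuartic
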